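import Literature.NumberTheory.Automorphic.LocalLanglandsGLOne
import Literature.NumberTheory.Automorphic.LocalConstantsUniqueness
import Literature.NumberTheory.GaloisRepresentations.WeilDeligneSemisimpleTraces
import Literature.NumberTheory.GaloisRepresentations.WeilDeligneFrobSemisimpleIff
import HarnessLib

/-!
# The split normal form of a two-dimensional Weil–Deligne representation with a stable line
(line `Sketch_18745_r1_k1`, crux `DyadicOddResidue.SectorComplement`, stmt-Langlands-18745;
stub `stub_isEquivalent_prod_of_line` of the rank-2 attack on generic rigidity)

Let `σ = (ρ, N)` be a Frobenius-semisimple Weil–Deligne representation of `W_F` on a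
two-dimensional complex space `V` with `N = 0`, and let `v ≠ 0` be a vector on which `W_F` acts
through the quasi-character `α ∘ artin`.  Then `σ ≅ L(α) ⊞ L(β)` for some quasi-character `β`:

* the line `ℓ = ℂ v` is `ρ`-stable, i.e. a `Subrepresentation` of `ρ`;
* `ρ` is a semisimple representation of `W_F`
  (`WeilDeligneRep.IsFrobSemisimple.isSemisimpleRepresentation`), so `ℓ` has a `ρ`-stable
  complement `m`, again a line (`dim V = 2`);
* `W_F` acts on `m` through a character `θ`
  (`Representation.existsUnique_character_of_finrank_eq_one`), continuous because `ρ` is trivial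
  on an open subgroup of inertia, hence `θ = β ∘ artin` for a quasi-character `β` of `Fˣ` (local
  class field theory for `GL₁`, `LocalArtinData.recGL1_surjective`);
* in the basis `(v, u)`, `u ∈ m ∖ 0`, the representation `σ` is `(α ∘ artin) ⊕ (β ∘ artin)` with
  `N = 0`, i.e. `ofQuasiCharOn ℂ α ⊞ ofQuasiCharOn ℂ β` on `ℂ × ℂ`.

References: J. Tate, *Number theoretic background*, Corvallis 1979, (4.1.4) (Frobenius-semisimple
representations with `N = 0` are direct sums of irreducibles), (2.2), (1.4.5); P. Deligne,
*Les constantes des équations fonctionnelles des fonctions L*, Antwerp II, LNM 349 (1973), §8.4–8.6.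
-/

noncomputable section

set_option linter.dupNamespace false

open Module Literature.NumberTheory.Automorphic Literature.NumberTheory.GaloisRepresentations

namespace Summit.Langlands.Langlands.Theorems.ReciprocityRigidity

variable {F : Type} [Field F] [ValuativeRel F] [TopologicalSpace F] [IsNonarchimedeanLocalField F]

/-- **Stub Split: a Frobenius-semisimple two-dimensional Weil–Deligne representation with
`N = 0` and a stable quasi-character line is a sum of two quasi-character lines.**  If `W_F` acts
on `v ≠ 0` through `α ∘ artin`, then `σ ≅ ofQuasiCharOn ℂ α ⊞ ofQuasiCharOn ℂ β` for some
quasi-character `β`: the stable line `ℂ v` has a stable complement `m` by semisimplicity of `ρ`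
(`IsFrobSemisimple.isSemisimpleRepresentation`), `m` is a line on which `W_F` acts through a
continuous character `θ = β ∘ artin` (`LocalArtinData.recGL1_surjective`), and the basis `(v, u)`,
`u ∈ m ∖ 0`, diagonalises `σ`. [cite: TateCorvallis1979, (4.1.4)] -/
theorem stub_isEquivalent_prod_of_line
    (hns : @WeilGroup.exists_subgroup_le_inertia_isOpen_of_continuous F _ _ _ _)
    (d : LocalArtinData F)
    {V : Type*} [AddCommGroup V] [Module ℂ V] [FiniteDimensional ℂ V] (hV : finrank ℂ V = 2)
    (σ : WeilDeligneRep F ℂ V) (hss : σ.IsFrobSemisimple) (hN : σ.N = 0)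
    (α : QuasiChar F) (v : V) (hv : v ≠ 0)
    (hαv : ∀ w : WeilGroup F, σ.ρ w v = ((α (d.artin w) : ℂˣ) : ℂ) • v) :
    ∃ β : QuasiChar F, σ.IsEquivalent
      ((WeilDeligneRep.ofQuasiCharOn ℂ hns d α).prod (WeilDeligneRep.ofQuasiCharOn ℂ hns d β)) := by
  -- the stable line `ℓ = ℂ v`, as a subrepresentation of `ρ`
  let ℓ : Subrepresentation σ.ρ :=
    { toSubmodule := ℂ ∙ v
      apply_mem_toSubmodule := fun w x hx => by
        rw [Submodule.mem_span_singleton] at hx ⊢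
        obtain ⟨a, rfl⟩ := hx
        exact ⟨a * ((α (d.artin w) : ℂˣ) : ℂ), by rw [map_smul, hαv w, smul_smul]⟩ }
  -- a stable complement `m` (semisimplicity of `ρ`)
  haveI : σ.ρ.IsSemisimpleRepresentation := hss.isSemisimpleRepresentation
  obtain ⟨m, hm⟩ := exists_isCompl ℓ
  have hm' : IsCompl (ℂ ∙ v) m.toSubmodule := by
    refine ⟨?_, ?_⟩
    · rw [disjoint_iff]
      exact congrArg Subrepresentation.toSubmodule (disjoint_iff.mp hm.disjoint)
    · rw [codisjoint_iff]
      exact congrArg Subrepresentation.toSubmodule (codisjoint_iff.mp hm.codisjoint)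
  -- `m` is a line
  have hm1 : finrank ℂ m.toSubmodule = 1 := by
    have h1 := Submodule.finrank_add_eq_of_isCompl hm'
    rw [finrank_span_singleton hv, hV] at h1
    omega
  -- `W_F` acts on `m` through a character `θ`
  obtain ⟨θ, hθ, -⟩ := m.toRepresentation.existsUnique_character_of_finrank_eq_one hm1
  haveI : Nontrivial m.toSubmodule := Module.nontrivial_of_finrank_eq_succ hm1
  obtain ⟨u', hu'⟩ := exists_ne (0 : m.toSubmodule)
  set u : V := (u' : V) with hu
  have hu0 : u ≠ 0 := fun h => hu' (Subtype.ext h)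
  have hum : u ∈ m.toSubmodule := u'.2
  have hθu : ∀ w : WeilGroup F, σ.ρ w u = ((θ w : ℂˣ) : ℂ) • u := fun w =>
    congrArg Subtype.val (hθ w u')
  -- `θ` is continuous (trivial on an open subgroup of inertia), hence `θ = β ∘ artin`
  have hcont : Continuous θ := by
    obtain ⟨U, -, hUo, hρU⟩ := σ.isContinuous
    refine WeilGroup.continuous_of_forall_mem_eq_one θ hUo fun w hw => Units.ext ?_
    refine smul_left_injective ℂ hu0 ?_
    simp only [Units.val_one, one_smul]
    rw [← hθu w, hρU w hw, Module.End.one_apply]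
  obtain ⟨β, hβ⟩ := d.recGL1_surjective ⟨θ, hcont⟩
  have hβw : ∀ w : WeilGroup F, ((β (d.artin w) : ℂˣ) : ℂ) = ((θ w : ℂˣ) : ℂ) := fun w => by
    rw [← LocalArtinData.recGL1_apply, hβ]
    rfl
  -- `(v, u)` is a basis of `V`
  have hli : LinearIndependent ℂ ![v, u] := by
    rw [LinearIndependent.pair_iff]
    intro s t hst
    have hsv : s • v ∈ m.toSubmodule := by
      rw [eq_neg_of_add_eq_zero_left hst]
      exact m.toSubmodule.neg_mem (m.toSubmodule.smul_mem t hum)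
    have hsv0 : s • v = 0 :=
      Submodule.disjoint_def.mp hm'.disjoint _
        (Submodule.smul_mem _ s (Submodule.mem_span_singleton_self v)) hsv
    have hs : s = 0 := (smul_eq_zero.mp hsv0).resolve_right hv
    refine ⟨hs, ?_⟩
    rw [hs, zero_smul, zero_add] at hst
    exact (smul_eq_zero.mp hst).resolve_right hu0
  have hcard : Fintype.card (Fin 2) = finrank ℂ V := by rw [Fintype.card_fin, hV]
  set b : Basis (Fin 2) ℂ V := basisOfLinearIndependentOfCardEqFinrank hli hcard with hb
  have hb0 : b 0 = v := by rw [hb, coe_basisOfLinearIndependentOfCardEqFinrank]; rfl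
  have hb1 : b 1 = u := by rw [hb, coe_basisOfLinearIndependentOfCardEqFinrank]; rfl
  -- the linear isomorphism `V ≃ ℂ × ℂ`, `v ↦ (1, 0)`, `u ↦ (0, 1)`
  set e : V ≃ₗ[ℂ] ℂ × ℂ := b.equiv (Basis.finTwoProd ℂ) (Equiv.refl (Fin 2)) with he
  have he0 : e v = (1, 0) := by
    rw [← hb0, he, Basis.equiv_apply, Equiv.refl_apply, Basis.finTwoProd_zero]
  have he1 : e u = (0, 1) := by
    rw [← hb1, he, Basis.equiv_apply, Equiv.refl_apply, Basis.finTwoProd_one]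
  -- equivariance on the basis, and `N = 0` on both sides
  refine ⟨β, ⟨{ toRepEquiv := Representation.Equiv.mk e fun w => ?_, comm_N := ?_ }⟩⟩
  · refine b.ext fun j => ?_
    fin_cases j
    · change e (σ.ρ w (b 0)) = ((WeilDeligneRep.ofQuasiCharOn ℂ hns d α).prod
        (WeilDeligneRep.ofQuasiCharOn ℂ hns d β)).ρ w (e (b 0))
      rw [hb0, hαv, map_smul, he0, WeilDeligneRep.prod_ρ_apply, LinearMap.prodMap_apply,
        WeilDeligneRep.ofQuasiCharOn_ρ_apply, WeilDeligneRep.ofQuasiCharOn_ρ_apply, Prod.smul_mk,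
        smul_zero, smul_zero]
    · change e (σ.ρ w (b 1)) = ((WeilDeligneRep.ofQuasiCharOn ℂ hns d α).prod
        (WeilDeligneRep.ofQuasiCharOn ℂ hns d β)).ρ w (e (b 1))
      rw [hb1, hθu, map_smul, he1, WeilDeligneRep.prod_ρ_apply, LinearMap.prodMap_apply,
        WeilDeligneRep.ofQuasiCharOn_ρ_apply, WeilDeligneRep.ofQuasiCharOn_ρ_apply, Prod.smul_mk,
        smul_zero, smul_zero, hβw]
  · change (e : V →ₗ[ℂ] ℂ × ℂ) ∘ₗ σ.N = ((WeilDeligneRep.ofQuasiCharOn ℂ hns d α).prod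
        (WeilDeligneRep.ofQuasiCharOn ℂ hns d β)).N ∘ₗ (e : V →ₗ[ℂ] ℂ × ℂ)
    rw [hN, WeilDeligneRep.prod_N, WeilDeligneRep.ofQuasiCharOn_N, WeilDeligneRep.ofQuasiCharOn_N,
      LinearMap.prodMap_zero, LinearMap.comp_zero, LinearMap.zero_comp]

end Summit.Langlands.Langlands.Theorems.ReciprocityRigidity

end
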